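import Summits.Ventures.HSemireg.WedgePointPairPowersLocal

/-!
# Venture HSemireg — per-`q` blocks of the `n`-fold box of `m`-dimensional point pairs, 2/4: TRANSPORT of the local model into
# block `i` of `Fin ((m+m)n)`, canonical sources, the Dolbeault index `q` (the generalisation of `WedgeSurfacePowersPerQ.lean` §2–§3)

HONEST FRAMING. Part of the Lean index of the computation cell `pub-hsemireg` (seat p10 gen 3, Sunday typer «UNIFORM-IN-n»).
Finite-dimensional EXTERIOR ALGEBRA over a field (and integer polynomial arithmetic) ONLY: no variety, no cohomology theory, no sheaf, no
Ext group, no semiregularity map is constructed here; nothing here says that HC / HC_CM / HC_AV holds; no Literature fact is declared or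
used.  Custodian versions: STRUCTURE.md v1.0-SIGNED 9b196a05977dd067 (§1.1 C10 / C13), theory/FORMULA-N.md PART A §4.1″ (th-6), PART B (th-7).

THIS FILE: lifts / pull-backs of letter sets along the block embedding `blockEmb m n i : Fin (m+m) ↪o Fin ((m+m)n)` of
`WedgePointPairPowers.lean`; `coord_emb` (coordinates along th-7's `Wedge.Kunneth.emb`); the local image `limg s i = E_{s ∩ D_i} ∧ f_i`
of a source and its block coordinates = local coordinates (`coord_limg_ne_zero_iff`); the canonical source `src f` of option data
`f : Fin n → Opt m` and `|s| = Σ_i |pb_i s|`; ALL `X`-generators `XX` (`mem_XX`: values `< m mod 2m`), the DOLBEAULT INDEX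
`qdeg T = #(XX ∖ T)` (number of `X`-generators missing from the target monomial — the WedgeBoxPerQ dictionary, quoted) and its
additivity over the blocks (`qdeg_eq_sum`).  Namespace `Summit.Ventures.HSemireg.Wedge.PairPowers`.
-/

open Module Set Set.powersetCard

namespace Summit.Ventures.HSemireg.Wedge.PairPowers

open Summit.Ventures.HSemireg.Wedge Summit.Ventures.HSemireg.Wedge.Kunneth

variable (K : Type*) [Field K] (m : ℕ)

/-! ## §2. Transport into block `i` of `Fin ((m+m)n)` -/

variable (n : ℕ)

/-- the lift of a set of local letters into block `i`: `t ↦ {2m·i + j : j ∈ t}`. -/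
def lift (i : Fin n) (t : Finset (Fin (m + m))) : Finset (Fin ((m + m) * n)) := t.map (blockEmb m n i).toEmbedding

/-- the pull-back of a set of generators to the local letters of block `i`. -/
def pb (i : Fin n) (T : Finset (Fin ((m + m) * n))) : Finset (Fin (m + m)) := Finset.univ.filter fun j => blockEmb m n i j ∈ T

variable {m n}

/-- membership in a lift. -/
lemma mem_lift {i : Fin n} {t : Finset (Fin (m + m))} {x : Fin ((m + m) * n)} : x ∈ lift m n i t ↔ ∃ j ∈ t, blockEmb m n i j = x := by
  simp [lift]

/-- membership in a pull-back. -/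
lemma mem_pb {i : Fin n} {T : Finset (Fin ((m + m) * n))} {j : Fin (m + m)} : j ∈ pb m n i T ↔ blockEmb m n i j ∈ T := by
  simp [pb]

/-- block arithmetic: a value in block `i` and in block `i'` forces `i = i'`. -/
lemma block_index_eq {b i i' x : ℕ} (h1 : b * i ≤ x) (h2 : x < b * i + b) (h3 : b * i' ≤ x) (h4 : x < b * i' + b) : i = i' := by
  have e1 : b * i < b * (i' + 1) := by rw [mul_add, mul_one]; omega
  have e2 : b * i' < b * (i + 1) := by rw [mul_add, mul_one]; omega
  have := Nat.lt_of_mul_lt_mul_left e1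
  have := Nat.lt_of_mul_lt_mul_left e2
  omega

/-- the block of a lifted letter. -/
lemma blockEmb_mem_D_iff {i i' : Fin n} {j : Fin (m + m)} : blockEmb m n i j ∈ D m n i' ↔ i = i' := by
  rw [mem_D, blockEmb_val]
  have := j.2
  constructor
  · intro h
    exact Fin.ext (block_index_eq (Nat.le_add_right _ _) (by omega) h.1 h.2)
  · rintro rfl; omega

/-- distinct blocks are disjoint. -/
lemma disjoint_D {i i' : Fin n} (h : i ≠ i') : Disjoint (D m n i) (D m n i') := by
  rw [Finset.disjoint_left]
  intro x h1 h2
  rw [mem_D] at h1 h2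
  exact h (Fin.ext (block_index_eq h1.1 h1.2 h2.1 h2.2))

/-- blocks are non-empty as soon as there is a generator. -/
lemma two_m_pos (x : Fin ((m + m) * n)) : 0 < m + m := by
  have hx : (x : ℕ) < (m + m) * n := x.2
  generalize (x : ℕ) = y at hx
  rcases Nat.eq_zero_or_pos (m + m) with h | h
  · rw [h, zero_mul] at hx; omega
  · exact h

/-- the block index of a generator. -/
lemma div_lt (x : Fin ((m + m) * n)) : (x : ℕ) / (m + m) < n := by
  have hb := two_m_pos x
  have hx : (x : ℕ) < (m + m) * n := x.2
  generalize (x : ℕ) = y at hx ⊢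
  exact (Nat.div_lt_iff_lt_mul hb).mpr (by rw [mul_comm]; exact hx)

/-- every generator lies in the block of its index. -/
lemma mem_D_div (x : Fin ((m + m) * n)) : x ∈ D m n ⟨x / (m + m), div_lt x⟩ := by
  rw [mem_D]
  exact ⟨Nat.mul_div_le _ _, by rw [← Nat.mul_succ]; exact Nat.lt_mul_div_succ _ (two_m_pos x)⟩

/-- a lift lies in its block. -/
lemma lift_subset_D (i : Fin n) (t : Finset (Fin (m + m))) : lift m n i t ⊆ D m n i := by
  intro x hx
  obtain ⟨j, -, rfl⟩ := mem_lift.mp hx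
  exact blockEmb_mem_D_iff.mpr rfl

/-- lifting the pull-back recovers the part of `T` in block `i`. -/
lemma lift_pb (i : Fin n) (T : Finset (Fin ((m + m) * n))) : lift m n i (pb m n i T) = T ∩ D m n i := by
  ext x
  rw [mem_lift, Finset.mem_inter]
  constructor
  · rintro ⟨j, hj, rfl⟩
    exact ⟨mem_pb.mp hj, blockEmb_mem_D_iff.mpr rfl⟩
  · rintro ⟨hT, hD⟩
    rw [D, Finset.mem_map] at hD
    obtain ⟨j, -, rfl⟩ := hD
    exact ⟨j, mem_pb.mpr hT, rfl⟩

/-- pulling back a lift recovers the local letters. -/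
lemma pb_lift (i : Fin n) (t : Finset (Fin (m + m))) : pb m n i (lift m n i t) = t := by
  ext j
  rw [mem_pb, mem_lift]
  constructor
  · rintro ⟨j', hj', e⟩
    rwa [← (blockEmb m n i).injective e]
  · intro hj
    exact ⟨j, hj, rfl⟩

/-- cardinality of a lift. -/
lemma card_lift (i : Fin n) (t : Finset (Fin (m + m))) : (lift m n i t).card = t.card := Finset.card_map _

/-- **coordinates transport along the block embedding**: the `lift T₀`-coordinate of an embedded element is its local
`T₀`-coordinate. -/
theorem coord_emb (i : Fin n) (T₀ : Finset (Fin (m + m))) (v : HT K (Fin (m + m))) :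
    (B K (Fin ((m + m) * n))).coord (lift m n i T₀) (emb K (blockEmb m n i) v) = (B K (Fin (m + m))).coord T₀ v := by
  have key : (B K (Fin ((m + m) * n))).coord (lift m n i T₀) ∘ₗ (emb K (blockEmb m n i)).toLinearMap = (B K (Fin (m + m))).coord T₀ := by
    apply (B K (Fin (m + m))).ext
    intro t
    rw [LinearMap.comp_apply, AlgHom.toLinearMap_apply, emb_B, SurfacePowers.coord_B, SurfacePowers.coord_B]
    simp only [lift, (Finset.map_injective (blockEmb m n i).toEmbedding).eq_iff]
  rw [← key, LinearMap.comp_apply, AlgHom.toLinearMap_apply]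

/-! ### The local image of a source on block `i` -/

/-- the LOCAL IMAGE of a source monomial `E_s` on block `i`: `E_{s ∩ D_i} ∧ f_i`. -/
noncomputable def limg (a c : K) (s : Finset (Fin ((m + m) * n))) (i : Fin n) : HT K (Fin ((m + m) * n)) :=
  B K (Fin ((m + m) * n)) (s ∩ D m n i) * pfac K a c i

/-- the local image is the embedded local product `E_{pb s} ∧ (a E_X + c E_Y)`. -/
lemma limg_eq_emb (a c : K) (s : Finset (Fin ((m + m) * n))) (i : Fin n) :
    limg K a c s i = emb K (blockEmb m n i) (B K (Fin (m + m)) (pb m n i s) * pp K m a c) := by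
  rw [limg, map_mul, emb_B, ← lift_pb]
  rfl

/-- the local image lies in the block algebra. -/
lemma limg_mem_Alg (a c : K) (s : Finset (Fin ((m + m) * n))) (i : Fin n) : limg K a c s i ∈ Alg K (Fin ((m + m) * n)) (D m n i) :=
  mul_mem_Alg K (B_mem_Alg K Finset.inter_subset_right) (Hom_le_Alg K _ _ (pfac_mem_Hom K a c i))

/-- **block coordinates of the local image are local coordinates**: the `T ∩ D_i`-coordinate of `E_{s ∩ D_i} ∧ f_i` is the local
coordinate of `E_{pb s} ∧ (a E_X + c E_Y)` at `pb T`. -/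
theorem coord_limg (a c : K) (s T : Finset (Fin ((m + m) * n))) (i : Fin n) :
    (B K (Fin ((m + m) * n))).coord (T ∩ D m n i) (limg K a c s i) =
      (B K (Fin (m + m))).coord (pb m n i T) (B K (Fin (m + m)) (pb m n i s) * pp K m a c) := by
  rw [limg_eq_emb, ← lift_pb, coord_emb]

/-- so it is non-zero iff `pb T` is a local target of `pb s` (`a, c ≠ 0`). -/
theorem coord_limg_ne_zero_iff (hm : 1 ≤ m) {a c : K} (ha : a ≠ 0) (hc : c ≠ 0) (s T : Finset (Fin ((m + m) * n))) (i : Fin n) :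
    (B K (Fin ((m + m) * n))).coord (T ∩ D m n i) (limg K a c s i) ≠ 0 ↔ pb m n i T ∈ ltg m (pb m n i s) := by
  rw [coord_limg, coord_B_mul_pp_ne_zero_iff hm ha hc]


/-! ## §3. Canonical sources from option data, and the Dolbeault index `q` on `Fin ((m+m)n)` -/

/-- the CANONICAL SOURCE of option data `f` (one canonical local source per block): `⋃_i lift_i ((f i).1)`. -/
def src (f : Fin n → Opt m) : Finset (Fin ((m + m) * n)) := Finset.univ.biUnion fun i => lift m n i ((f i).1)

/-- block `i` of the canonical source is the chosen local source. -/
lemma pb_src (f : Fin n → Opt m) (i : Fin n) : pb m n i (src f) = (f i).1 := by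
  ext j
  rw [mem_pb, src, Finset.mem_biUnion]
  constructor
  · rintro ⟨i', -, h⟩
    obtain rfl : i = i' := blockEmb_mem_D_iff.mp (lift_subset_D i' _ h)
    obtain ⟨j', hj', e⟩ := mem_lift.mp h
    rwa [← (blockEmb m n i).injective e]
  · intro hj
    exact ⟨i, Finset.mem_univ _, mem_lift.mpr ⟨j, hj, rfl⟩⟩

/-- the degree of the canonical source is the sum of the local degrees. -/
lemma card_src (f : Fin n → Opt m) : (src f).card = ∑ i, ((f i).1).card := by
  rw [src, Finset.card_biUnion]
  · exact Finset.sum_congr rfl fun i _ => card_lift i _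
  · intro i _ i' _ h
    exact disjoint_of_subsets (disjoint_D h) (lift_subset_D i _) (lift_subset_D i' _)

/-- every generator lies in exactly one block: the pull-backs of `s` partition it, so `|s| = Σ_i |pb_i s|`. -/
lemma card_eq_sum_card_pb (s : Finset (Fin ((m + m) * n))) : s.card = ∑ i, (pb m n i s).card := by
  have hs : s = Finset.univ.biUnion fun i => lift m n i (pb m n i s) := by
    ext x
    rw [Finset.mem_biUnion]
    constructor
    · intro hx
      refine ⟨⟨x / (m + m), div_lt x⟩, Finset.mem_univ _, ?_⟩
      rw [lift_pb, Finset.mem_inter]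
      exact ⟨hx, mem_D_div x⟩
    · rintro ⟨i, -, h⟩
      rw [lift_pb, Finset.mem_inter] at h
      exact h.1
  conv_lhs => rw [hs]
  rw [Finset.card_biUnion]
  · exact Finset.sum_congr rfl fun i _ => card_lift i _
  · intro i _ i' _ h
    exact disjoint_of_subsets (disjoint_D h) (lift_subset_D i _) (lift_subset_D i' _)

variable (m n)

/-- ALL `X`-generators of `Fin ((m+m)n)`: the lifts of the `X` halves (values `< m mod 2m`). -/
def XX : Finset (Fin ((m + m) * n)) := Finset.univ.biUnion fun i => lift m n i (Xs m)

/-- the DOLBEAULT INDEX `q` of a target monomial `E_T`: the number of `X`-generators missing from `T` (the WedgeBoxPerQ dictionary,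
quoted: `X`-letters model `H⁰(T)`-directions, so a target in `H^{q+m}(Ω^q)` misses exactly `q` of them; additive over the blocks). -/
def qdeg (T : Finset (Fin ((m + m) * n))) : ℕ := (XX m n \ T).card

variable {m n}

/-- membership in `XX` by value: `x mod 2m < m`. -/
lemma mem_XX {x : Fin ((m + m) * n)} : x ∈ XX m n ↔ (x : ℕ) % (m + m) < m := by
  have hb := two_m_pos x
  rw [XX, Finset.mem_biUnion]
  constructor
  · rintro ⟨i, -, h⟩
    obtain ⟨j, hj, rfl⟩ := mem_lift.mp h
    rw [WedgePair.mem_Xset] at hj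
    rw [blockEmb_val, Nat.mul_add_mod, Nat.mod_eq_of_lt j.2]
    exact hj
  · intro hx
    refine ⟨⟨x / (m + m), div_lt x⟩, Finset.mem_univ _, mem_lift.mpr ⟨⟨x % (m + m), Nat.mod_lt _ hb⟩, ?_, Fin.ext ?_⟩⟩
    · rw [WedgePair.mem_Xset]; exact hx
    · rw [blockEmb_val]; exact Nat.div_add_mod x (m + m)

/-- **`q` is additive over the blocks**: `qdeg T = Σ_i lq (pb_i T)`. -/
theorem qdeg_eq_sum (T : Finset (Fin ((m + m) * n))) : qdeg m n T = ∑ i, lq m (pb m n i T) := by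
  have h1 : XX m n \ T = Finset.univ.biUnion fun i => lift m n i (Xs m \ pb m n i T) := by
    ext x
    rw [Finset.mem_sdiff, XX, Finset.mem_biUnion, Finset.mem_biUnion]
    constructor
    · rintro ⟨⟨i, -, h⟩, hT⟩
      obtain ⟨j, hj, rfl⟩ := mem_lift.mp h
      exact ⟨i, Finset.mem_univ _, mem_lift.mpr ⟨j, Finset.mem_sdiff.mpr ⟨hj, fun h' => hT (mem_pb.mp h')⟩, rfl⟩⟩
    · rintro ⟨i, -, h⟩
      obtain ⟨j, hj, rfl⟩ := mem_lift.mp h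
      rw [Finset.mem_sdiff] at hj
      exact ⟨⟨i, Finset.mem_univ _, mem_lift.mpr ⟨j, hj.1, rfl⟩⟩, fun h' => hj.2 (mem_pb.mpr h')⟩
  rw [qdeg, h1, Finset.card_biUnion]
  · exact Finset.sum_congr rfl fun i _ => card_lift i _
  · intro i _ i' _ h
    exact disjoint_of_subsets (disjoint_D h) (lift_subset_D i _) (lift_subset_D i' _)

end Summit.Ventures.HSemireg.Wedge.PairPowers
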